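import Summits.QuantumFields.YangMills.Theorems.BalabanUVNodesN12AtRecord13Prop1KnitAtZSeq
import Literature.MathematicalPhysics.QuantumFieldTheory.Balaban1983to89.B15Prop1DatumSmall7AtZSequence
import Literature.MathematicalPhysics.QuantumFieldTheory.Balaban1983to89.Node00.Record13NumericsOfThm1CCM

/-!
# BalabanUVNodes ∕ N12 — THE s1∕s2 JUNCTION AT PRINT's (1.74) OBJECT WITH THE NEAR-VALUE LETTER (Vn) RETIRED: N12's ROW AT THE LIVE RE-PIN, `N = 2`, PER INSTANCE AT NODE 00's CONSTRUCTOR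
# OF RECORD AT `Z`'s OWN MAXIMAL SEQUENCE, ITS PROPOSITION-1 DISPLAY FED BY dag-n12-c's `B15Prop1DatumSmall7AtZSequence` — [IV] p.193 ll.14–20 «V_k′ = Ṽ_k on Z … satisfies all the above
# conditions … by Theorem 1 [15]» typed: (Vn) derived from [15] Theorem 1 (R) AT `Z`'s SEQUENCE + r11's (2.13) geometry + bookkeeping (Track A, DAG node N12 = [B15, Balaban1989LargeFieldI]
# CMP **122** (1989) 175–202; cluster K1: K1⁷ `StabilityBAtRecordR13SepCoPH` = stmt-QuantumFields-20542 (N12's rows are edition-free); seat `pub-ymgap-dag-n12-d` g13 (R134 s2 = by-name knit at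
# the record), 2026-08-27; count-neutral, NOT a discharge)

HONEST FRAMING.  Count-neutral kernel COMPOSITION BY NAME: this seat's 12Q‴ §2 pattern (12E's background-free, 𝐓-weight-free row `b15Leaf_WOfRecord₁₃_liveRepin₁₃_of_massLive_of_hasResiduals`
with its `hP1 : Prop1Printed (λ.LF P)` display FED run by run; `areg` — print's `a₁`, p. 194 — produced by Proposition 1's proof via `choose`) over dag-n12-c's NEW endpoint
`exists_domain_prop1Printed_lfVarOn_std_su2_box_intrinsic_analytic_atZSeqCoPRecord_ofThm1AtZSeq` (2026-08-27 g11) = its p544746 §2 VERBATIM with the letter `hVn` REPLACED by (Gᵃ) `hZblk` (`Z` a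
union of `k`-blocks), (Gᵇ) `hR0` ∕ `hRsucc` (the (7) ranges of `Z`'s maximal sequence lie inside `Z`; r11's (2.13) geometry, displayed), the bookkeeping `hcE` ∕ `heRa` ∕ `hB₃` ∕ `hcA`, and the
INSTANCE-LEVEL letter `h15Z` = [15] Theorem 1 (R) at `Z`'s sequence.  WHAT IS GONE relative to 12Q‴ §2: the near-value letter (Vn) `hVn` — no bespoke analytic letter is left on that road.  WHAT STAYS
A LETTER: regions `Z P i ∕ Λ P i`, levels `k P i`, `M P i`, box data; (J1) `hGj` and (L2) `hlead` + `hsm` ∕ `hγle` ([15] Thm 1 ∕ Prop 9-level inputs — NODE 00's ∕ [LF-II] pp.357–359); `h15Z`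
([15] Thm 1 (R) itself — NODE 00's general-sequence [15]-leaf serves it by ONE application, dag-n12-c LOCATED-GENFORM); the (2.13) geometry (Gᵃ)(Gᵇ); `hcJ'`; the box inclusion `hZ1` (⇒ `hfar`
by `far_letter_of_box`); `hk0` ∕ `hk`; K0b's residuals `hres` (§1); N12's per-run displays BELOW THE TORUS (the (1.100) pin equation, live-mass — NODE 00 —, (1.80), (1.89) — dag-n12-e's pins).
Nothing of Bałaban's is asserted; N12 is NOT discharged; no node is discharged; counts unmoved (discharged 5∕27 · Track A 5∕28).  TYPING NOTE: as in 12Q‴, every hypothesis body and the pinned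
`LF` term are written at the AMBIENT bond decidability of the Record-13 cone, dag-n12-c's endpoint taking `[hdec]` with `hcl := Subsingleton.elim _ _`; `IsBlockUnion` ∕ `blockIter` are written
`B14.Eq22Determines.…` (NODE 00 homonyms).  ONE finite four-torus programme at fixed `ε = L^{-K}` — nothing continuum ∕ ℝ⁴ ∕ OS ∕ mass gap ∕ Clay.
-/

noncomputable section
open MeasureTheory Set Finset Metric
open scoped Matrix.Norms.L2Operator BigOperators Matrix RealInnerProductSpace Real InnerProductSpace

namespace Summit.QuantumFields.YangMills.BalabanUVNodes.N12AtRecord13Prop1KnitThm1AtZSeq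

open Literature.MathematicalPhysics.QuantumFieldTheory.Balaban1983to89
open Literature.MathematicalPhysics.QuantumFieldTheory.Balaban1983to89.T4Continuum (T4Family)
open Literature.MathematicalPhysics.QuantumFieldTheory.Balaban1983to89.DagBinding
open Literature.MathematicalPhysics.QuantumFieldTheory.Balaban1983to89.Node00
open B15Claim189Assembly (new189 chiPP dom)
open B15 (Prop1Printed Ineq180)
open B15.BasicStep (Claim189)
open B8Eq17ClassAkV1 (plaqsOf)
open B15RPrime1100OfRep (rPrimeDataOfSel)
open Summit.QuantumFields.YangMills.BalabanUVNodes.N12AtRecord13OfResiduals (b15Leaf_WOfRecord₁₃_liveRepin₁₃_of_massLive_of_hasResiduals)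
-- dag-n12-c's vocabulary (as opened in `B15Prop1IntrinsicAnalyticAtRecord`)
open B15DeterminingSets (pts DetBackground genSet IsMinimizer MSField)
open B15Prop1Carrier (lfVarOn InstOn InstOn.std plaqsInside)
open B15Prop1DatumSmall7AtZSequence (exists_domain_prop1Printed_lfVarOn_std_su2_box_intrinsic_analytic_atZSeqCoPRecord_ofThm1AtZSeq
  exists_domain_prop1Printed_lfVarOn_std_su2_box_intrinsic_analytic_atZSeqCoPRecord_ofThm1AtZSeq_geom)
open B15Prop1GradientFromNearValueAtCoPRecord (far_letter_of_box)
open B15Prop1AnalyticExtClause (cplxVec anExt)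
open B15Prop1ChartCalculusSU2 (E3)
open T4CubeChartGnomonic (SU2)
open B15Prop1ChartSU2 (su2Chart)
open B15Prop1SliceCoordinates (GaugeSlice ιA)
open B15Prop1SliceTaylorCalculus (rGrad sliceFn)
open T4AxialGaugeSmallField (castSite boxPlaqs)
open B6BondElimination (unitVec)
open B16Eq18Proof (box)
open B15Extension193 (extend)
open B15ShellGauge193 (shellGauge)
open B5Bounds167Lattice (formDk ofRealCfg)
open B15Sect1Instances (fun177std)
open B14.Eq213DetSet (Bj maxDomT)
open B16Sect1Backgrounds (expMul)
open GaugeField (gaugeAct)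

variable {F : T4Family}

/-! ## §1. `N = 2`, generic `Θ` carrying node00-def-K0b's residuals: 12Q‴ §2 with (Vn) discharged from [15] Thm 1 (R) at `Z`'s sequence — (Gᵇ) displayed (§1a) ∕ discharged (§1b) -/
section RecordAtZSeq
variable (Θ : Stage13Params F 2) (lam : ResidW F 2)

/-- **★★★ N12's ROW BELOW THE TORUS AT THE LIVE RE-PIN, `N = 2`, AT PRINT's (1.74) OBJECT, THE (Vn) DISPLAY RETIRED** — 12Q‴ §2 (`…_of_nearValueLetters_atZSeqCoPRecord`) with its near-value letter
`hVn` DISCHARGED, run by run, by dag-n12-c's `B15Prop1DatumSmall7AtZSequence.exists_domain_prop1Printed_lfVarOn_std_su2_box_intrinsic_analytic_atZSeqCoPRecord_ofThm1AtZSeq` ([IV] p.193 ll.14–20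
«V_k′ = Ṽ_k on Z … satisfies all the above conditions … by Theorem 1 [15]»: the mixed (7) field collapses on consistent data, `Q^{s*}` pull-backs are (7)-small on block unions, the extension is
`c_E ε`-regular, the near-value bound follows from (8)₁): per instance the background is NODE 00's v1.5 constructor at `Z`'s OWN maximal sequence `bgMSCoPOfRecord F 2 Θ.ν P.K (k P i) (maxDomT Θ.ν.M₁ (Z P i))`,
the pinned LF layer and the conclusion VERBATIM 12Q‴ §2's.  WHAT REPLACES (Vn): (Gᵃ) `hZblk`, (Gᵇ) `hR0` ∕ `hRsucc` (r11's (2.13) geometry, displayed here — §1b discharges them), the bookkeeping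
`hcE` ∕ `heRa` ∕ `hB₃` ∕ `hcA`, and the INSTANCE-LEVEL [15] THEOREM 1 (R) AT `Z`'s SEQUENCE `h15Z` (the body of NODE 00's `VariationalThm1RegSepTop7M` after its prefix at `s.Ω := maxDomT ν.M₁ Z`).  WHAT STAYS: (J1) `hGj`,
(L2) `hlead` + `hsm` ∕ `hγle`, `hcJ'`, the box inclusion `hZ1`, `hk0` ∕ `hk`, box data; K0b's residuals `hres`; N12's per-run displays below the torus ((1.100) pin, live-mass, (1.80), (1.89)).  AFTER THIS ROW
no bespoke analytic letter is left on the (Vn) road of N12's Proposition-1 junction.  Count-neutral; NOT a discharge of N12. [cite: Balaban1989LargeFieldI, (0.2)–(0.6) p.176, (1.74) p.192, p.193 ll.14–20, Prop. 1 (1.77)–(1.78) p.194, (1.80) p.195, (1.89) p.198, (1.99)–(1.102) pp.200–201; Balaban1989LargeFieldII, (1.7)–(1.9) p.358, (1.11)–(1.13) p.359; Balaban1988Convergent, p.255, (2.12)–(2.13) pp.256–257, (2.16) p.257, (3.16) p.268; Balaban1985Variational, (2),(5),(6),(7) p.278, Thm 1 (8) p.279, Prop. 9 p.309 (bookkeeping)]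 -/
theorem exists_pinLF_b15Leaf_WOfRecord₁₃_liveRepin₁₃_of_massLive_of_hasResiduals_of_thm1AtZSeqLetters_atZSeqCoPRecord (hres : Θ.HasResidualsOfRecord F 2)
    -- N12's displays at the letters `kSel ∕ D189 ∕ D1100` of `λ`, run by run, BELOW THE TORUS
    (hpin : ∀ P : B12.RunParams, lam.kSel P < P.K → lam.D1100 P
      = rPrimeDataOfSel (reprTOfRecord₁₃ F 2 (Θ.liveRepin₁₃ F 2) P (lam.kSel P))
          ((Θ.liveRepin₁₃ F 2).ppSel P (gOfRecord₁₃ F 2 (Θ.liveRepin₁₃ F 2) P) (lam.kSel P + 1))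
          (fibOfSeq F (Θ.liveRepin₁₃ F 2).ν (Θ.liveRepin₁₃ F 2).τ9 P (gOfRecord₁₃ F 2 (Θ.liveRepin₁₃ F 2) P) (lam.kSel P + 1)))
    (hmassLive : ∀ P : B12.RunParams, lam.kSel P < P.K → ∀ s, LiveSeq F 2 Θ.ν Θ.τ9 P (gOfRecord₁₃ F 2 (Θ.liveRepin₁₃ F 2) P) (lam.kSel P + 1)
        (slotsTOfRecord F 2 Θ.ν Θ.τ9 (EOfRecord₁₃ F 2 (Θ.liveRepin₁₃ F 2)) (wOfRecord₉ F 2 (Θ.liveRepin₁₃ F 2).toStage9Params)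
          (Θ.liveRepin₁₃ F 2).ppSel P (gOfRecord₁₃ F 2 (Θ.liveRepin₁₃ F 2) P) (lam.kSel P + 1)) s →
      0 < ∫ V, rterm (reprTOfRecord₁₃ F 2 (Θ.liveRepin₁₃ F 2) P (lam.kSel P)) s V ∂(fieldMeasure (F.P P.K) (lam.kSel P + 1) (SU 2)))
    (h180 : ∀ P : B12.RunParams, lam.kSel P < P.K → ∀ U, new189 (lam.D189 P) U → ∀ i, (lam.D189 P).h ≤ i → i ≤ (lam.D189 P).k →
      ∀ q ∈ plaqsOf (dom (lam.D189 P) i),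
        Ineq180 ((lam.D189 P).dev0 U q) ((lam.D189 P).ε (lam.D189 P).k) (lam.D189 P).η (lam.D189 P).B₃ (lam.D189 P).B₅ (lam.D189 P).M (lam.D189 P).δ
          ((lam.D189 P).dist q) (lam.D189 P).O1)
    (h189 : ∀ P : B12.RunParams, lam.kSel P < P.K → Claim189 (new189 (lam.D189 P)) (chiPP (lam.D189 P)))
    -- dag-n12-c's Proposition-1 instance data ON THE RUN's LATTICE `F.P P.K`, per run `P` and instance `i : ι P` (structural ∕ constants, exactly as in its endpoint of record)
    (hd3 : ∀ P : B12.RunParams, 3 ≤ (F.P P.K).d) (h0 : ∀ P : B12.RunParams, 0 < (F.P P.K).d) (ι : B12.RunParams → Type)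
    -- NO background letters: per instance the class is that of `Z P i`'s OWN maximal sequence `maxDomT Θ.ν.M₁ (Z P i)` up to scale `k P i` (dag-n12-c LOCATED-CLASS)
    (Z Λ : ∀ P : B12.RunParams, ι P → Set (Site (F.P P.K) 0))
    (k : ∀ P : B12.RunParams, ι P → ℕ) (M : ∀ P : B12.RunParams, ι P → ℝ) (hk0 : ∀ P i, 0 < k P i) (hk : ∀ P i, k P i ≤ (F.P P.K).m + (F.P P.K).K)
    (eR : ∀ P : B12.RunParams, ι P → ℝ) (heR : ∀ P i, 0 < eR P i)
    (T : ∀ (P : B12.RunParams) (i : ι P), Finset (PBond (F.P P.K) (k P i)))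
    (lo hi : ∀ P : B12.RunParams, ι P → Fin (F.P P.K).d → ℤ) (n : ∀ P : B12.RunParams, ι P → ℕ) (hn : ∀ P i κ, hi P i κ ≤ lo P i κ + n P i)
    (hN : ∀ P i, n P i + 2 < (F.P P.K).sitesPerDir (k P i))
    (hbox : ∀ P i, pts (k P i) (Λ P i) = (castSite '' Set.Icc (lo P i) (hi P i) : Set (Site (F.P P.K) (k P i))))
    (hZ : ∀ P i, (boxPlaqs (lo P i - 1) (hi P i + 1) : Set (Plaq (F.P P.K) (k P i))) ⊆ plaqsInside (pts (k P i) (Z P i)))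
    (hTG0 : ∀ P i, T P i = (box (fun κ => (hi P i κ - lo P i κ + 1).toNat) (lo P i)).image fun x =>
      (⟨castSite (x - unitVec ⟨0, h0 P⟩), ⟨0, h0 P⟩⟩ : PBond (F.P P.K) (k P i)))
    (hN5 : ∀ P i κ, ((hi P i κ - lo P i κ + 1).toNat : ℤ) + 5 < (F.P P.K).sitesPerDir (k P i))
    (Kb : ∀ P : B12.RunParams, ι P → ℕ) (hK1 : ∀ P i, 1 ≤ Kb P i) (hKn : ∀ P i κ, (hi P i κ - lo P i κ + 1).toNat ≤ Kb P i)
    (ext : ∀ (P : B12.RunParams) (i : ι P), GaugeField (F.P P.K) (k P i) SU2 → GaugeField (F.P P.K) (k P i) SU2)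
    (hext : ∀ P i Vk, ext P i Vk = extend (pts (k P i) (Λ P i)) (shellGauge Vk (lo P i) (hi P i)) Vk)
    (hlohi : ∀ P i, lo P i ≤ hi P i)
    {γ cJ bx : B12.RunParams → ℝ} (hγ : ∀ P, 0 < γ P) (hcJ : ∀ P, 0 ≤ cJ P) (hbx : ∀ P, 0 ≤ bx P)
    (hbxM : ∀ P i, 12 * ((F.P P.K).d : ℝ) * ((n P i : ℝ) + 2) ^ 2 ≤ bx P * (M P i) ^ 2)
    {Cerr R 𝓐 : ∀ P : B12.RunParams, ι P → ℝ} (hM : ∀ P i, 1 ≤ M P i) (hR : ∀ P i, 0 < R P i) (h𝓐 : ∀ P i, 0 ≤ 𝓐 P i)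
    (n' : ∀ P : B12.RunParams, ι P → ℕ) (hn' : ∀ P i, 1 ≤ n' P i)
    -- (J1) the JOINT holomorphic extension of print's function in the datum perturbation and the field
    (hGj : ∀ P i Vk, PlaqSmallOn (plaqsInside (pts (k P i) (Z P i ∩ (Λ P i)ᶜ))) (eR P i) Vk →
      ∃ 𝒢 : VecField (F.P P.K) (k P i) (EuclideanSpace ℂ (Fin 3)) × VecField (F.P P.K) (k P i) (EuclideanSpace ℂ (Fin 3)) → ℂ,
        DifferentiableOn ℂ 𝒢 (ball 0 (R P i)) ∧
        (∀ z ∈ ball (0 : VecField (F.P P.K) (k P i) (EuclideanSpace ℂ (Fin 3)) × VecField (F.P P.K) (k P i) (EuclideanSpace ℂ (Fin 3))) (R P i), ‖𝒢 z‖ ≤ 𝓐 P i) ∧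
        ∀ p B' : VecField (F.P P.K) (k P i) E3, ‖p‖ < R P i → ‖B'‖ < R P i →
          𝒢 (cplxVec p, cplxVec B') =
            ((fun177std (bgMSCoPOfRecord F 2 Θ.ν P.K (k P i) (maxDomT Θ.ν.M₁ (Z P i))) Θ.ν.M₁ (Z P i) (k P i) (expMul su2Chart B' (ext P i (expMul su2Chart p Vk))) : ℝ) : ℂ))
    -- (L2) (1.7)–(1.9) p.358 for the Hessian of the slice function at `0`
    (hlead : ∀ P i Vk, PlaqSmallOn (plaqsInside (pts (k P i) (Z P i ∩ (Λ P i)ᶜ))) (eR P i) Vk →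
      ∀ X : GaugeSlice (pts (k P i) (Λ P i)) (T P i) E3,
      |⟪X, (fderiv ℝ (rGrad (pts (k P i) (Λ P i)) (T P i)
              (sliceFn (pts (k P i) (Λ P i)) (T P i) (fun177std (bgMSCoPOfRecord F 2 Θ.ν P.K (k P i) (maxDomT Θ.ν.M₁ (Z P i))) Θ.ν.M₁ (Z P i) (k P i)) (ext P i Vk))) 0) X⟫ -
          ∑ a : Fin 3, formDk (n' P i) (fun _ : Fin (F.P P.K).d => (F.P P.K).sitesPerDir (k P i))
            (ofRealCfg (fun _ : Fin (F.P P.K).d => (F.P P.K).sitesPerDir (k P i)) fun j =>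
              ιA (pts (k P i) (Λ P i)) (T P i) X ⟨j.1, j.2⟩ a)| ≤ Cerr P i * ‖X‖ ^ 2)
    (hsm : ∀ P i, Cerr P i ≤ (4 / Real.pi ^ 2) ^ ((F.P P.K).d + 2) / (2 * (3 * (Kb P i : ℝ) ^ 2 + 2 * (Kb P i : ℝ) ^ 4)))
    (hγle : ∀ P i, γ P / (M P i) ^ 5 ≤ (4 / Real.pi ^ 2) ^ ((F.P P.K).d + 2) / (2 * (3 * (Kb P i : ℝ) ^ 2 + 2 * (Kb P i : ℝ) ^ 4)))
    -- the geometric letter: every fine site whose k-block label lies in the box `[lo − 1, hi + 1]` lies in `Ω₁(Z)` (print: `Λ` deep inside `Z`); dag-n12-c's `far_letter_of_box` turns it into the bond letter `hfar`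
    (hZ1 : ∀ P i (y : Site (F.P P.K) 0), B14.Eq22Determines.blockIter (k P i) y ∈ (castSite '' Set.Icc (lo P i - 1) (hi P i + 1) : Set (Site (F.P P.K) (k P i))) → y ∈ maxDomT Θ.ν.M₁ (Z P i) 1)
    -- (Gᵃ) `Z` a union of `k`-blocks (print's `Z` is a union of `M`-cubes of `T₁^{(k)}`)
    (hZblk : ∀ P i, B14.Eq22Determines.IsBlockUnion (k P i) (Z P i))
    -- (Gᵇ) the (7) ranges of `Z`'s maximal sequence (2.13) lie inside `Z` (r11's (2.13) geometry, DISPLAYED; §1b discharges it from `2 ≤ M₁` and the torus divisibility)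
    (hR0 : ∀ P i, Node00.Sect2.printedPlaqsTop (maxDomT Θ.ν.M₁ (Z P i)) (Node00.suppDomOfRecord F Θ.ν P.K (maxDomT Θ.ν.M₁ (Z P i))) (k P i) ⊆ plaqsInside (Z P i))
    (hRsucc : ∀ P i m, m + 1 ≤ k P i → Node00.Sect2.printedPlaqs (maxDomT Θ.ν.M₁ (Z P i)) (k P i) (m + 1) ⊆ plaqsInside (pts (m + 1) (Z P i)))
    -- bookkeeping constants of the (Vn) derivation (`c_E`, print's `B₃` of [15] Thm 1, the threshold `a₁'`, the near-value constant `c_A`), per run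
    {cE B₃ a₁' cA : B12.RunParams → ℝ} (hcE0 : ∀ P, 0 ≤ cE P) (hcE : ∀ P i, 12 * ((F.P P.K).d : ℝ) * ((n P i : ℝ) + 2) ^ 2 ≤ cE P) (hB₃ : ∀ P, 0 ≤ B₃ P)
    (heRa : ∀ P i, (cE P + 1) * eR P i ≤ a₁' P ∧ B₃ P * ((cE P + 1) * eR P i) ≤ Θ.ν.εreg)
    (hcA : ∀ P, 1 / 2 * (B₃ P * (cE P + 1) * (F.P P.K).eta 1 ^ 2) ^ 2 * (Fintype.card (Plaq (F.P P.K) 0) : ℝ) ≤ cA P)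
    -- [15] THEOREM 1 (R) AT `Z`'s OWN SEQUENCE, per run and instance (dag-n12-c's instance-level letter `h15Z`; NODE 00's general-sequence [15]-leaf serves it by ONE application — dag-n12-c LOCATED-GENFORM)
    (h15Z : ∀ P i (δ : ℕ → ℝ), (∀ j, j ≤ k P i → 0 < δ j ∧ δ j ≤ a₁' P ∧ B₃ P * δ j ≤ Θ.ν.εreg) → (∀ j, j < k P i → δ j ≤ 2 * δ (j + 1)) →
      (∀ j, j < k P i → δ (j + 1) ≤ 2 * δ j) →
      ∀ W : MSField (F.P P.K) SU2,
        Node00.Sect2.DataSmall7PTop (Node00.avOfRecord F 2 P.K) (maxDomT Θ.ν.M₁ (Z P i)) (Node00.suppDomOfRecord F Θ.ν P.K (maxDomT Θ.ν.M₁ (Z P i))) (k P i) δ W →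
        ∀ U₀ : GaugeField (F.P P.K) 0 SU2, IsMinimizer (Node00.avOfRecord F 2 P.K)
            {U | (∀ j, j ≤ k P i → PlaqSmallOn (Node00.Sect2.omegaPlaqsTop (maxDomT Θ.ν.M₁ (Z P i)) (Node00.suppDomOfRecord F Θ.ν P.K (maxDomT Θ.ν.M₁ (Z P i))) j)
                ((Θ.ν.εreg : ℝ) * (F.P P.K).eta j ^ 2) U) ∧
              Node00.Sect2.CoDivClassOnTop (maxDomT Θ.ν.M₁ (Z P i)) (Node00.suppDomOfRecord F Θ.ν P.K (maxDomT Θ.ν.M₁ (Z P i))) (k P i) Θ.ν.εreg U}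
            (genSet (maxDomT Θ.ν.M₁ (Z P i)) (k P i)) W U₀ →
          (∀ j, j ≤ k P i → PlaqSmallOn (Node00.Sect2.omegaPlaqsTop (maxDomT Θ.ν.M₁ (Z P i)) (Node00.suppDomOfRecord F Θ.ν P.K (maxDomT Θ.ν.M₁ (Z P i))) j)
              (B₃ P * δ j * (F.P P.K).eta j ^ 2) U₀) ∧
            ∀ j, j ≤ k P i → Node00.Sect2.CoDivSmallOn (Node00.Sect2.omegaBondsTop (maxDomT Θ.ν.M₁ (Z P i)) (Node00.suppDomOfRecord F Θ.ν P.K (maxDomT Θ.ν.M₁ (Z P i))) j)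
              (B₃ P * δ j * (F.P P.K).eta j ^ 3) U₀)
    (hcJ' : ∀ P i, 2 * cA P * eR P i / R P i + 4 * 𝓐 P i / (R P i * eR P i) ≤ cJ P) :
    ∃ areg : ∀ P : B12.RunParams, ι P → ℝ, (∀ P i, 0 < areg P i) ∧
      ∀ P : B12.RunParams, lam.kSel P < P.K →
        B15Leaf (WOfRecord₁₃ F 2 (Θ.liveRepin₁₃ F 2)
          { lam with LF := fun P => lfVarOn su2Chart fun i => InstOn.std (bgMSCoPOfRecord F 2 Θ.ν P.K (k P i) (maxDomT Θ.ν.M₁ (Z P i))) Θ.ν.M₁ (Z P i) (Λ P i) (k P i) (M P i) (areg P i)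
                            (anExt (pts (k P i) (Λ P i)) (T P i) (fun177std (bgMSCoPOfRecord F 2 Θ.ν P.K (k P i) (maxDomT Θ.ν.M₁ (Z P i))) Θ.ν.M₁ (Z P i) (k P i)) (ext P i)
                              (min (1 / 2) (min (R P i / 8) (γ P / (M P i) ^ 5 * (R P i / 2) ^ 2 / (48 * (4 * 𝓐 P i / R P i + 1)))))) } P) := by
  choose areg ha hP using fun P : B12.RunParams =>
    exists_domain_prop1Printed_lfVarOn_std_su2_box_intrinsic_analytic_atZSeqCoPRecord_ofThm1AtZSeq (F := F) Θ.ν P.K (hd3 P) (h0 P) (hcl := Subsingleton.elim _ _)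
      (Z := Z P) (Λ := Λ P) (k := k P) (M := M P) (hk0 := hk0 P) (hk := hk P) (eR := eR P) (heR := heR P) (T := T P) (lo := lo P) (hi := hi P) (n := n P) (hn := hn P)
      (hN := hN P) (hbox := hbox P) (hZ := hZ P) (hTG0 := hTG0 P) (hN5 := hN5 P) (K := Kb P) (hK1 := hK1 P) (hKn := hKn P) (ext := ext P) (hext := hext P) (hlohi := hlohi P)
      (hγ := hγ P) (hcJ := hcJ P) (hbx := hbx P) (hbxM := hbxM P) (hM := hM P) (hR := hR P) (h𝓐 := h𝓐 P) (n' := n' P) (hn' := hn' P) (hGj := hGj P) (hlead := hlead P)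
      (hsm := hsm P) (hγle := hγle P) (hfar := fun i b hb => far_letter_of_box (hbox P i) (hZ1 P i) b hb) (hZblk := hZblk P) (hR0 := hR0 P) (hRsucc := hRsucc P)
      (hcE0 := hcE0 P) (hcE := hcE P) (hB₃ := hB₃ P) (heRa := heRa P) (hcA := hcA P) (h15Z := h15Z P) (hcJ' := hcJ' P)
  refine ⟨areg, ha, fun P hkP => ?_⟩
  apply b15Leaf_WOfRecord₁₃_liveRepin₁₃_of_massLive_of_hasResiduals Θ _ hres (P := P)
  · exact hkP
  · exact hpin P hkP
  · exact hmassLive P hkP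
  · exact hP P
  · exact h180 P hkP
  · exact h189 P hkP

/-- **★★★ THE SAME ROW WITH THE (2.13) GEOMETRY (Gᵇ) DISCHARGED** (dag-n12-c's `…_atZSeqCoPRecord_ofThm1AtZSeq_geom`: (Gᵇ) derived at print's `Z` from `2 ≤ M₁` and the torus divisibility
`L^{k}·M₁ ∣ 2L^{m+K}` — `printedPlaqs[Top]_maxDomT_subset_plaqsInside`): letters `hM2 : 2 ≤ Θ.ν.M₁` (print: `M₁ = L^{m₁}`, [6] (1.3)–(1.6); met at every collared witness, NOT at the unit branch
`θ₁₅ᶜ` ∕ `θ₁₅ᶜᶜ¹` — use §1a there) and `hdiv` per instance (run geometry, displayed); everything else as §1a without `hR0` ∕ `hRsucc`.  Count-neutral; NOT a discharge of N12. [cite: Balaban1989LargeFieldI, (0.2)–(0.6) p.176, (1.74) p.192, p.193 ll.14–20, Prop. 1 (1.77)–(1.78) p.194, (1.80) p.195, (1.89) p.198, (1.99)–(1.102) pp.200–201; Balaban1989LargeFieldII, (1.7)–(1.9) p.358, (1.11)–(1.13) p.359; Balaban1988Convergent, p.255, (2.12)–(2.13) pp.256–257, (2.16) p.257, (3.16)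 p.268; Balaban1985Variational, (2),(5),(6),(7) p.278, Thm 1 (8) p.279, Prop. 9 p.309 (bookkeeping)] -/
theorem exists_pinLF_b15Leaf_WOfRecord₁₃_liveRepin₁₃_of_massLive_of_hasResiduals_of_thm1AtZSeqLetters_atZSeqCoPRecord_geom (hres : Θ.HasResidualsOfRecord F 2)
    -- N12's displays at the letters `kSel ∕ D189 ∕ D1100` of `λ`, run by run, BELOW THE TORUS
    (hpin : ∀ P : B12.RunParams, lam.kSel P < P.K → lam.D1100 P
      = rPrimeDataOfSel (reprTOfRecord₁₃ F 2 (Θ.liveRepin₁₃ F 2) P (lam.kSel P))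
          ((Θ.liveRepin₁₃ F 2).ppSel P (gOfRecord₁₃ F 2 (Θ.liveRepin₁₃ F 2) P) (lam.kSel P + 1))
          (fibOfSeq F (Θ.liveRepin₁₃ F 2).ν (Θ.liveRepin₁₃ F 2).τ9 P (gOfRecord₁₃ F 2 (Θ.liveRepin₁₃ F 2) P) (lam.kSel P + 1)))
    (hmassLive : ∀ P : B12.RunParams, lam.kSel P < P.K → ∀ s, LiveSeq F 2 Θ.ν Θ.τ9 P (gOfRecord₁₃ F 2 (Θ.liveRepin₁₃ F 2) P) (lam.kSel P + 1)
        (slotsTOfRecord F 2 Θ.ν Θ.τ9 (EOfRecord₁₃ F 2 (Θ.liveRepin₁₃ F 2)) (wOfRecord₉ F 2 (Θ.liveRepin₁₃ F 2).toStage9Params)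
          (Θ.liveRepin₁₃ F 2).ppSel P (gOfRecord₁₃ F 2 (Θ.liveRepin₁₃ F 2) P) (lam.kSel P + 1)) s →
      0 < ∫ V, rterm (reprTOfRecord₁₃ F 2 (Θ.liveRepin₁₃ F 2) P (lam.kSel P)) s V ∂(fieldMeasure (F.P P.K) (lam.kSel P + 1) (SU 2)))
    (h180 : ∀ P : B12.RunParams, lam.kSel P < P.K → ∀ U, new189 (lam.D189 P) U → ∀ i, (lam.D189 P).h ≤ i → i ≤ (lam.D189 P).k →
      ∀ q ∈ plaqsOf (dom (lam.D189 P) i),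
        Ineq180 ((lam.D189 P).dev0 U q) ((lam.D189 P).ε (lam.D189 P).k) (lam.D189 P).η (lam.D189 P).B₃ (lam.D189 P).B₅ (lam.D189 P).M (lam.D189 P).δ
          ((lam.D189 P).dist q) (lam.D189 P).O1)
    (h189 : ∀ P : B12.RunParams, lam.kSel P < P.K → Claim189 (new189 (lam.D189 P)) (chiPP (lam.D189 P)))
    -- dag-n12-c's Proposition-1 instance data ON THE RUN's LATTICE `F.P P.K`, per run `P` and instance `i : ι P` (structural ∕ constants, exactly as in its endpoint of record)
    (hd3 : ∀ P : B12.RunParams, 3 ≤ (F.P P.K).d) (h0 : ∀ P : B12.RunParams, 0 < (F.P P.K).d) (ι : B12.RunParams → Type)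
    -- NO background letters: per instance the class is that of `Z P i`'s OWN maximal sequence `maxDomT Θ.ν.M₁ (Z P i)` up to scale `k P i` (dag-n12-c LOCATED-CLASS)
    (Z Λ : ∀ P : B12.RunParams, ι P → Set (Site (F.P P.K) 0))
    (k : ∀ P : B12.RunParams, ι P → ℕ) (M : ∀ P : B12.RunParams, ι P → ℝ) (hk0 : ∀ P i, 0 < k P i) (hk : ∀ P i, k P i ≤ (F.P P.K).m + (F.P P.K).K)
    (eR : ∀ P : B12.RunParams, ι P → ℝ) (heR : ∀ P i, 0 < eR P i)
    (T : ∀ (P : B12.RunParams) (i : ι P), Finset (PBond (F.P P.K) (k P i)))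
    (lo hi : ∀ P : B12.RunParams, ι P → Fin (F.P P.K).d → ℤ) (n : ∀ P : B12.RunParams, ι P → ℕ) (hn : ∀ P i κ, hi P i κ ≤ lo P i κ + n P i)
    (hN : ∀ P i, n P i + 2 < (F.P P.K).sitesPerDir (k P i))
    (hbox : ∀ P i, pts (k P i) (Λ P i) = (castSite '' Set.Icc (lo P i) (hi P i) : Set (Site (F.P P.K) (k P i))))
    (hZ : ∀ P i, (boxPlaqs (lo P i - 1) (hi P i + 1) : Set (Plaq (F.P P.K) (k P i))) ⊆ plaqsInside (pts (k P i) (Z P i)))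
    (hTG0 : ∀ P i, T P i = (box (fun κ => (hi P i κ - lo P i κ + 1).toNat) (lo P i)).image fun x =>
      (⟨castSite (x - unitVec ⟨0, h0 P⟩), ⟨0, h0 P⟩⟩ : PBond (F.P P.K) (k P i)))
    (hN5 : ∀ P i κ, ((hi P i κ - lo P i κ + 1).toNat : ℤ) + 5 < (F.P P.K).sitesPerDir (k P i))
    (Kb : ∀ P : B12.RunParams, ι P → ℕ) (hK1 : ∀ P i, 1 ≤ Kb P i) (hKn : ∀ P i κ, (hi P i κ - lo P i κ + 1).toNat ≤ Kb P i)
    (ext : ∀ (P : B12.RunParams) (i : ι P), GaugeField (F.P P.K) (k P i) SU2 → GaugeField (F.P P.K) (k P i) SU2)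
    (hext : ∀ P i Vk, ext P i Vk = extend (pts (k P i) (Λ P i)) (shellGauge Vk (lo P i) (hi P i)) Vk)
    (hlohi : ∀ P i, lo P i ≤ hi P i)
    {γ cJ bx : B12.RunParams → ℝ} (hγ : ∀ P, 0 < γ P) (hcJ : ∀ P, 0 ≤ cJ P) (hbx : ∀ P, 0 ≤ bx P)
    (hbxM : ∀ P i, 12 * ((F.P P.K).d : ℝ) * ((n P i : ℝ) + 2) ^ 2 ≤ bx P * (M P i) ^ 2)
    {Cerr R 𝓐 : ∀ P : B12.RunParams, ι P → ℝ} (hM : ∀ P i, 1 ≤ M P i) (hR : ∀ P i, 0 < R P i) (h𝓐 : ∀ P i, 0 ≤ 𝓐 P i)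
    (n' : ∀ P : B12.RunParams, ι P → ℕ) (hn' : ∀ P i, 1 ≤ n' P i)
    -- (J1) the JOINT holomorphic extension of print's function in the datum perturbation and the field
    (hGj : ∀ P i Vk, PlaqSmallOn (plaqsInside (pts (k P i) (Z P i ∩ (Λ P i)ᶜ))) (eR P i) Vk →
      ∃ 𝒢 : VecField (F.P P.K) (k P i) (EuclideanSpace ℂ (Fin 3)) × VecField (F.P P.K) (k P i) (EuclideanSpace ℂ (Fin 3)) → ℂ,
        DifferentiableOn ℂ 𝒢 (ball 0 (R P i)) ∧
        (∀ z ∈ ball (0 : VecField (F.P P.K) (k P i) (EuclideanSpace ℂ (Fin 3)) × VecField (F.P P.K) (k P i) (EuclideanSpace ℂ (Fin 3))) (R P i), ‖𝒢 z‖ ≤ 𝓐 P i) ∧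
        ∀ p B' : VecField (F.P P.K) (k P i) E3, ‖p‖ < R P i → ‖B'‖ < R P i →
          𝒢 (cplxVec p, cplxVec B') =
            ((fun177std (bgMSCoPOfRecord F 2 Θ.ν P.K (k P i) (maxDomT Θ.ν.M₁ (Z P i))) Θ.ν.M₁ (Z P i) (k P i) (expMul su2Chart B' (ext P i (expMul su2Chart p Vk))) : ℝ) : ℂ))
    -- (L2) (1.7)–(1.9) p.358 for the Hessian of the slice function at `0`
    (hlead : ∀ P i Vk, PlaqSmallOn (plaqsInside (pts (k P i) (Z P i ∩ (Λ P i)ᶜ))) (eR P i) Vk →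
      ∀ X : GaugeSlice (pts (k P i) (Λ P i)) (T P i) E3,
      |⟪X, (fderiv ℝ (rGrad (pts (k P i) (Λ P i)) (T P i)
              (sliceFn (pts (k P i) (Λ P i)) (T P i) (fun177std (bgMSCoPOfRecord F 2 Θ.ν P.K (k P i) (maxDomT Θ.ν.M₁ (Z P i))) Θ.ν.M₁ (Z P i) (k P i)) (ext P i Vk))) 0) X⟫ -
          ∑ a : Fin 3, formDk (n' P i) (fun _ : Fin (F.P P.K).d => (F.P P.K).sitesPerDir (k P i))
            (ofRealCfg (fun _ : Fin (F.P P.K).d => (F.P P.K).sitesPerDir (k P i)) fun j =>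
              ιA (pts (k P i) (Λ P i)) (T P i) X ⟨j.1, j.2⟩ a)| ≤ Cerr P i * ‖X‖ ^ 2)
    (hsm : ∀ P i, Cerr P i ≤ (4 / Real.pi ^ 2) ^ ((F.P P.K).d + 2) / (2 * (3 * (Kb P i : ℝ) ^ 2 + 2 * (Kb P i : ℝ) ^ 4)))
    (hγle : ∀ P i, γ P / (M P i) ^ 5 ≤ (4 / Real.pi ^ 2) ^ ((F.P P.K).d + 2) / (2 * (3 * (Kb P i : ℝ) ^ 2 + 2 * (Kb P i : ℝ) ^ 4)))
    -- the geometric letter: every fine site whose k-block label lies in the box `[lo − 1, hi + 1]` lies in `Ω₁(Z)` (print: `Λ` deep inside `Z`); dag-n12-c's `far_letter_of_box` turns it into the bond letter `hfar`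
    (hZ1 : ∀ P i (y : Site (F.P P.K) 0), B14.Eq22Determines.blockIter (k P i) y ∈ (castSite '' Set.Icc (lo P i - 1) (hi P i + 1) : Set (Site (F.P P.K) (k P i))) → y ∈ maxDomT Θ.ν.M₁ (Z P i) 1)
    -- (Gᵃ) `Z` a union of `k`-blocks (print's `Z` is a union of `M`-cubes of `T₁^{(k)}`)
    (hZblk : ∀ P i, B14.Eq22Determines.IsBlockUnion (k P i) (Z P i))
    -- (Gᵇ) DISCHARGED (dag-n12-c §8): print's `M₁ ≥ 2` and, per instance, the torus divisibility `L^{k}·M₁ ∣ 2L^{m+K}` of the `LʲM₁`-cube partitions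
    (hM2 : 2 ≤ Θ.ν.M₁) (hdiv : ∀ P i, B14.Eq213MaximalDomains.side (F.P P.K).L Θ.ν.M₁ (k P i) ∣ (F.P P.K).sitesPerDir 0)
    -- bookkeeping constants of the (Vn) derivation (`c_E`, print's `B₃` of [15] Thm 1, the threshold `a₁'`, the near-value constant `c_A`), per run
    {cE B₃ a₁' cA : B12.RunParams → ℝ} (hcE0 : ∀ P, 0 ≤ cE P) (hcE : ∀ P i, 12 * ((F.P P.K).d : ℝ) * ((n P i : ℝ) + 2) ^ 2 ≤ cE P) (hB₃ : ∀ P, 0 ≤ B₃ P)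
    (heRa : ∀ P i, (cE P + 1) * eR P i ≤ a₁' P ∧ B₃ P * ((cE P + 1) * eR P i) ≤ Θ.ν.εreg)
    (hcA : ∀ P, 1 / 2 * (B₃ P * (cE P + 1) * (F.P P.K).eta 1 ^ 2) ^ 2 * (Fintype.card (Plaq (F.P P.K) 0) : ℝ) ≤ cA P)
    -- [15] THEOREM 1 (R) AT `Z`'s OWN SEQUENCE, per run and instance (dag-n12-c's instance-level letter `h15Z`; NODE 00's general-sequence [15]-leaf serves it by ONE application — dag-n12-c LOCATED-GENFORM)
    (h15Z : ∀ P i (δ : ℕ → ℝ), (∀ j, j ≤ k P i → 0 < δ j ∧ δ j ≤ a₁' P ∧ B₃ P * δ j ≤ Θ.ν.εreg) → (∀ j, j < k P i → δ j ≤ 2 * δ (j + 1)) →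
      (∀ j, j < k P i → δ (j + 1) ≤ 2 * δ j) →
      ∀ W : MSField (F.P P.K) SU2,
        Node00.Sect2.DataSmall7PTop (Node00.avOfRecord F 2 P.K) (maxDomT Θ.ν.M₁ (Z P i)) (Node00.suppDomOfRecord F Θ.ν P.K (maxDomT Θ.ν.M₁ (Z P i))) (k P i) δ W →
        ∀ U₀ : GaugeField (F.P P.K) 0 SU2, IsMinimizer (Node00.avOfRecord F 2 P.K)
            {U | (∀ j, j ≤ k P i → PlaqSmallOn (Node00.Sect2.omegaPlaqsTop (maxDomT Θ.ν.M₁ (Z P i)) (Node00.suppDomOfRecord F Θ.ν P.K (maxDomT Θ.ν.M₁ (Z P i))) j)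
                ((Θ.ν.εreg : ℝ) * (F.P P.K).eta j ^ 2) U) ∧
              Node00.Sect2.CoDivClassOnTop (maxDomT Θ.ν.M₁ (Z P i)) (Node00.suppDomOfRecord F Θ.ν P.K (maxDomT Θ.ν.M₁ (Z P i))) (k P i) Θ.ν.εreg U}
            (genSet (maxDomT Θ.ν.M₁ (Z P i)) (k P i)) W U₀ →
          (∀ j, j ≤ k P i → PlaqSmallOn (Node00.Sect2.omegaPlaqsTop (maxDomT Θ.ν.M₁ (Z P i)) (Node00.suppDomOfRecord F Θ.ν P.K (maxDomT Θ.ν.M₁ (Z P i))) j)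
              (B₃ P * δ j * (F.P P.K).eta j ^ 2) U₀) ∧
            ∀ j, j ≤ k P i → Node00.Sect2.CoDivSmallOn (Node00.Sect2.omegaBondsTop (maxDomT Θ.ν.M₁ (Z P i)) (Node00.suppDomOfRecord F Θ.ν P.K (maxDomT Θ.ν.M₁ (Z P i))) j)
              (B₃ P * δ j * (F.P P.K).eta j ^ 3) U₀)
    (hcJ' : ∀ P i, 2 * cA P * eR P i / R P i + 4 * 𝓐 P i / (R P i * eR P i) ≤ cJ P) :
    ∃ areg : ∀ P : B12.RunParams, ι P → ℝ, (∀ P i, 0 < areg P i) ∧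
      ∀ P : B12.RunParams, lam.kSel P < P.K →
        B15Leaf (WOfRecord₁₃ F 2 (Θ.liveRepin₁₃ F 2)
          { lam with LF := fun P => lfVarOn su2Chart fun i => InstOn.std (bgMSCoPOfRecord F 2 Θ.ν P.K (k P i) (maxDomT Θ.ν.M₁ (Z P i))) Θ.ν.M₁ (Z P i) (Λ P i) (k P i) (M P i) (areg P i)
                            (anExt (pts (k P i) (Λ P i)) (T P i) (fun177std (bgMSCoPOfRecord F 2 Θ.ν P.K (k P i) (maxDomT Θ.ν.M₁ (Z P i))) Θ.ν.M₁ (Z P i) (k P i)) (ext P i)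
                              (min (1 / 2) (min (R P i / 8) (γ P / (M P i) ^ 5 * (R P i / 2) ^ 2 / (48 * (4 * 𝓐 P i / R P i + 1)))))) } P) := by
  choose areg ha hP using fun P : B12.RunParams =>
    exists_domain_prop1Printed_lfVarOn_std_su2_box_intrinsic_analytic_atZSeqCoPRecord_ofThm1AtZSeq_geom (F := F) Θ.ν P.K (hd3 P) (h0 P) (hcl := Subsingleton.elim _ _)
      (Z := Z P) (Λ := Λ P) (k := k P) (M := M P) (hk0 := hk0 P) (hk := hk P) (eR := eR P) (heR := heR P) (T := T P) (lo := lo P) (hi := hi P) (n := n P) (hn := hn P)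
      (hN := hN P) (hbox := hbox P) (hZ := hZ P) (hTG0 := hTG0 P) (hN5 := hN5 P) (K := Kb P) (hK1 := hK1 P) (hKn := hKn P) (ext := ext P) (hext := hext P) (hlohi := hlohi P)
      (hγ := hγ P) (hcJ := hcJ P) (hbx := hbx P) (hbxM := hbxM P) (hM := hM P) (hR := hR P) (h𝓐 := h𝓐 P) (n' := n' P) (hn' := hn' P) (hGj := hGj P) (hlead := hlead P)
      (hsm := hsm P) (hγle := hγle P) (hfar := fun i b hb => far_letter_of_box (hbox P i) (hZ1 P i) b hb) (hZblk := hZblk P) (hM2 := hM2) (hdiv := hdiv P)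
      (hcE0 := hcE0 P) (hcE := hcE P) (hB₃ := hB₃ P) (heRa := heRa P) (hcA := hcA P) (h15Z := h15Z P) (hcJ' := hcJ' P)
  refine ⟨areg, ha, fun P hkP => ?_⟩
  apply b15Leaf_WOfRecord₁₃_liveRepin₁₃_of_massLive_of_hasResiduals Θ _ hres (P := P)
  · exact hkP
  · exact hpin P hkP
  · exact hmassLive P hkP
  · exact hP P
  · exact h180 P hkP
  · exact h189 P hkP
end RecordAtZSeq

/-! ## §2. At the collared K0⁷ witness of record `θ₁₅ᶜᶜᴹ(jM)` (dag-n21-c (γ) re-pin): §1b with ZERO K0-side hypotheses and `M₁ ≥ 2` discharged -/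
section AtThm1CCM
variable (jM : ℕ) (ε₀ ε₂₉ B₃c B₃' a₀ a₁ : ℝ) (lam : ResidW F 2)

/-- **★★★ THE SAME ROW AT THE COLLARED K0⁷ WITNESS `θ₁₅ᶜᶜᴹ(jM) = theta13OfThm1CCM F 2 jM ε₀ ε₂₉ B₃c B₃' a₀ a₁`, (Gᵇ) AND `M₁ ≥ 2` DISCHARGED** (dag-n21-c FILE A; §1b at
`Θ := theta13OfNumerics … (stage12NumericsOfThm1CCM F.L jM …) …`, whose ₁₃ live re-pin IS `θ₁₅ᶜᶜᴹ(jM)` by `rfl`, K0b's residuals by K0a's `hasResidualsOfRecord_theta13OfNumerics`; `2 ≤ M₁ = L^{jM}` from `1 ≤ jM` and `1 < L`):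
ZERO K0-side hypotheses; the numerics letters of the Proposition-1 instance data READ the witness (`ν.M₁ = L^{jM}` is the layer width of `Z`'s maximal sequence `maxDomT ν.M₁ Z`, `ν.εreg = a₀` the (7)-threshold in
`heRa` ∕ `h15Z`).  The witness letter `B₃c` is K0a's (2.8)-constant slot of the numerics (renamed: `B₃` is the [15]-Thm-1 constant family of the bookkeeping).  Count-neutral; NOT a discharge of N12.
[cite: Balaban1989LargeFieldI, (0.2)–(0.6) p.176, (1.74) p.192, p.193 ll.14–20, Prop. 1 (1.77)–(1.78) p.194, (1.80) p.195, (1.89) p.198, (1.99)–(1.102) pp.200–201; Balaban1988Convergent, (2.12)–(2.13) pp.256–257, (3.16) p.268, (3.22)–(3.25) pp.269–270; Balaban1985RegularSpaces, (1.3)–(1.6) p.77 (witness letter); Balaban1985Variational, Thm 1 (8) p.279 (bookkeeping)] -/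
theorem exists_pinLF_b15Leaf_WOfRecord₁₃_theta13OfThm1CCM_of_massLive_of_thm1AtZSeqLetters_atZSeqCoPRecord_geom (hjM : 1 ≤ jM)
    -- N12's displays at the letters `kSel ∕ D189 ∕ D1100` of `λ`, run by run, BELOW THE TORUS
    (hpin : ∀ P : B12.RunParams, lam.kSel P < P.K → lam.D1100 P
      = rPrimeDataOfSel (reprTOfRecord₁₃ F 2 (theta13OfThm1CCM F 2 jM ε₀ ε₂₉ B₃c B₃' a₀ a₁) P (lam.kSel P))
          ((theta13OfThm1CCM F 2 jM ε₀ ε₂₉ B₃c B₃' a₀ a₁).ppSel P (gOfRecord₁₃ F 2 (theta13OfThm1CCM F 2 jM ε₀ ε₂₉ B₃c B₃' a₀ a₁) P) (lam.kSel P + 1))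
          (fibOfSeq F (theta13OfThm1CCM F 2 jM ε₀ ε₂₉ B₃c B₃' a₀ a₁).ν (theta13OfThm1CCM F 2 jM ε₀ ε₂₉ B₃c B₃' a₀ a₁).τ9 P (gOfRecord₁₃ F 2 (theta13OfThm1CCM F 2 jM ε₀ ε₂₉ B₃c B₃' a₀ a₁) P) (lam.kSel P + 1)))
    (hmassLive : ∀ P : B12.RunParams, lam.kSel P < P.K → ∀ s, LiveSeq F 2 (theta13OfThm1CCM F 2 jM ε₀ ε₂₉ B₃c B₃' a₀ a₁).ν (theta13OfThm1CCM F 2 jM ε₀ ε₂₉ B₃c B₃' a₀ a₁).τ9 P (gOfRecord₁₃ F 2 (theta13OfThm1CCM F 2 jM ε₀ ε₂₉ B₃c B₃' a₀ a₁) P) (lam.kSel P + 1)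
        (slotsTOfRecord F 2 (theta13OfThm1CCM F 2 jM ε₀ ε₂₉ B₃c B₃' a₀ a₁).ν (theta13OfThm1CCM F 2 jM ε₀ ε₂₉ B₃c B₃' a₀ a₁).τ9 (EOfRecord₁₃ F 2 (theta13OfThm1CCM F 2 jM ε₀ ε₂₉ B₃c B₃' a₀ a₁)) (wOfRecord₉ F 2 (theta13OfThm1CCM F 2 jM ε₀ ε₂₉ B₃c B₃' a₀ a₁).toStage9Params)
          (theta13OfThm1CCM F 2 jM ε₀ ε₂₉ B₃c B₃' a₀ a₁).ppSel P (gOfRecord₁₃ F 2 (theta13OfThm1CCM F 2 jM ε₀ ε₂₉ B₃c B₃' a₀ a₁) P) (lam.kSel P + 1)) s →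
      0 < ∫ V, rterm (reprTOfRecord₁₃ F 2 (theta13OfThm1CCM F 2 jM ε₀ ε₂₉ B₃c B₃' a₀ a₁) P (lam.kSel P)) s V ∂(fieldMeasure (F.P P.K) (lam.kSel P + 1) (SU 2)))
    (h180 : ∀ P : B12.RunParams, lam.kSel P < P.K → ∀ U, new189 (lam.D189 P) U → ∀ i, (lam.D189 P).h ≤ i → i ≤ (lam.D189 P).k →
      ∀ q ∈ plaqsOf (dom (lam.D189 P) i),
        Ineq180 ((lam.D189 P).dev0 U q) ((lam.D189 P).ε (lam.D189 P).k) (lam.D189 P).η (lam.D189 P).B₃ (lam.D189 P).B₅ (lam.D189 P).M (lam.D189 P).δ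
          ((lam.D189 P).dist q) (lam.D189 P).O1)
    (h189 : ∀ P : B12.RunParams, lam.kSel P < P.K → Claim189 (new189 (lam.D189 P)) (chiPP (lam.D189 P)))
    -- dag-n12-c's Proposition-1 instance data ON THE RUN's LATTICE `F.P P.K`, per run `P` and instance `i : ι P` (structural ∕ constants, exactly as in its endpoint of record)
    (hd3 : ∀ P : B12.RunParams, 3 ≤ (F.P P.K).d) (h0 : ∀ P : B12.RunParams, 0 < (F.P P.K).d) (ι : B12.RunParams → Type)
    -- NO background letters: per instance the class is that of `Z P i`'s OWN maximal sequence `maxDomT (theta13OfThm1CCM F 2 jM ε₀ ε₂₉ B₃c B₃' a₀ a₁).ν.M₁ (Z P i)` up to scale `k P i` (dag-n12-c LOCATED-CLASS)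
    (Z Λ : ∀ P : B12.RunParams, ι P → Set (Site (F.P P.K) 0))
    (k : ∀ P : B12.RunParams, ι P → ℕ) (M : ∀ P : B12.RunParams, ι P → ℝ) (hk0 : ∀ P i, 0 < k P i) (hk : ∀ P i, k P i ≤ (F.P P.K).m + (F.P P.K).K)
    (eR : ∀ P : B12.RunParams, ι P → ℝ) (heR : ∀ P i, 0 < eR P i)
    (T : ∀ (P : B12.RunParams) (i : ι P), Finset (PBond (F.P P.K) (k P i)))
    (lo hi : ∀ P : B12.RunParams, ι P → Fin (F.P P.K).d → ℤ) (n : ∀ P : B12.RunParams, ι P → ℕ) (hn : ∀ P i κ, hi P i κ ≤ lo P i κ + n P i)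
    (hN : ∀ P i, n P i + 2 < (F.P P.K).sitesPerDir (k P i))
    (hbox : ∀ P i, pts (k P i) (Λ P i) = (castSite '' Set.Icc (lo P i) (hi P i) : Set (Site (F.P P.K) (k P i))))
    (hZ : ∀ P i, (boxPlaqs (lo P i - 1) (hi P i + 1) : Set (Plaq (F.P P.K) (k P i))) ⊆ plaqsInside (pts (k P i) (Z P i)))
    (hTG0 : ∀ P i, T P i = (box (fun κ => (hi P i κ - lo P i κ + 1).toNat) (lo P i)).image fun x =>
      (⟨castSite (x - unitVec ⟨0, h0 P⟩), ⟨0, h0 P⟩⟩ : PBond (F.P P.K) (k P i)))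
    (hN5 : ∀ P i κ, ((hi P i κ - lo P i κ + 1).toNat : ℤ) + 5 < (F.P P.K).sitesPerDir (k P i))
    (Kb : ∀ P : B12.RunParams, ι P → ℕ) (hK1 : ∀ P i, 1 ≤ Kb P i) (hKn : ∀ P i κ, (hi P i κ - lo P i κ + 1).toNat ≤ Kb P i)
    (ext : ∀ (P : B12.RunParams) (i : ι P), GaugeField (F.P P.K) (k P i) SU2 → GaugeField (F.P P.K) (k P i) SU2)
    (hext : ∀ P i Vk, ext P i Vk = extend (pts (k P i) (Λ P i)) (shellGauge Vk (lo P i) (hi P i)) Vk)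
    (hlohi : ∀ P i, lo P i ≤ hi P i)
    {γ cJ bx : B12.RunParams → ℝ} (hγ : ∀ P, 0 < γ P) (hcJ : ∀ P, 0 ≤ cJ P) (hbx : ∀ P, 0 ≤ bx P)
    (hbxM : ∀ P i, 12 * ((F.P P.K).d : ℝ) * ((n P i : ℝ) + 2) ^ 2 ≤ bx P * (M P i) ^ 2)
    {Cerr R 𝓐 : ∀ P : B12.RunParams, ι P → ℝ} (hM : ∀ P i, 1 ≤ M P i) (hR : ∀ P i, 0 < R P i) (h𝓐 : ∀ P i, 0 ≤ 𝓐 P i)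
    (n' : ∀ P : B12.RunParams, ι P → ℕ) (hn' : ∀ P i, 1 ≤ n' P i)
    -- (J1) the JOINT holomorphic extension of print's function in the datum perturbation and the field
    (hGj : ∀ P i Vk, PlaqSmallOn (plaqsInside (pts (k P i) (Z P i ∩ (Λ P i)ᶜ))) (eR P i) Vk →
      ∃ 𝒢 : VecField (F.P P.K) (k P i) (EuclideanSpace ℂ (Fin 3)) × VecField (F.P P.K) (k P i) (EuclideanSpace ℂ (Fin 3)) → ℂ,
        DifferentiableOn ℂ 𝒢 (ball 0 (R P i)) ∧
        (∀ z ∈ ball (0 : VecField (F.P P.K) (k P i) (EuclideanSpace ℂ (Fin 3)) × VecField (F.P P.K) (k P i) (EuclideanSpace ℂ (Fin 3))) (R P i), ‖𝒢 z‖ ≤ 𝓐 P i) ∧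
        ∀ p B' : VecField (F.P P.K) (k P i) E3, ‖p‖ < R P i → ‖B'‖ < R P i →
          𝒢 (cplxVec p, cplxVec B') =
            ((fun177std (bgMSCoPOfRecord F 2 (theta13OfThm1CCM F 2 jM ε₀ ε₂₉ B₃c B₃' a₀ a₁).ν P.K (k P i) (maxDomT (theta13OfThm1CCM F 2 jM ε₀ ε₂₉ B₃c B₃' a₀ a₁).ν.M₁ (Z P i))) (theta13OfThm1CCM F 2 jM ε₀ ε₂₉ B₃c B₃' a₀ a₁).ν.M₁ (Z P i) (k P i) (expMul su2Chart B' (ext P i (expMul su2Chart p Vk))) : ℝ) : ℂ))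
    -- (L2) (1.7)–(1.9) p.358 for the Hessian of the slice function at `0`
    (hlead : ∀ P i Vk, PlaqSmallOn (plaqsInside (pts (k P i) (Z P i ∩ (Λ P i)ᶜ))) (eR P i) Vk →
      ∀ X : GaugeSlice (pts (k P i) (Λ P i)) (T P i) E3,
      |⟪X, (fderiv ℝ (rGrad (pts (k P i) (Λ P i)) (T P i)
              (sliceFn (pts (k P i) (Λ P i)) (T P i) (fun177std (bgMSCoPOfRecord F 2 (theta13OfThm1CCM F 2 jM ε₀ ε₂₉ B₃c B₃' a₀ a₁).ν P.K (k P i) (maxDomT (theta13OfThm1CCM F 2 jM ε₀ ε₂₉ B₃c B₃' a₀ a₁).ν.M₁ (Z P i))) (theta13OfThm1CCM F 2 jM ε₀ ε₂₉ B₃c B₃' a₀ a₁).ν.M₁ (Z P i) (k P i)) (ext P i Vk))) 0) X⟫ -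
          ∑ a : Fin 3, formDk (n' P i) (fun _ : Fin (F.P P.K).d => (F.P P.K).sitesPerDir (k P i))
            (ofRealCfg (fun _ : Fin (F.P P.K).d => (F.P P.K).sitesPerDir (k P i)) fun j =>
              ιA (pts (k P i) (Λ P i)) (T P i) X ⟨j.1, j.2⟩ a)| ≤ Cerr P i * ‖X‖ ^ 2)
    (hsm : ∀ P i, Cerr P i ≤ (4 / Real.pi ^ 2) ^ ((F.P P.K).d + 2) / (2 * (3 * (Kb P i : ℝ) ^ 2 + 2 * (Kb P i : ℝ) ^ 4)))
    (hγle : ∀ P i, γ P / (M P i) ^ 5 ≤ (4 / Real.pi ^ 2) ^ ((F.P P.K).d + 2) / (2 * (3 * (Kb P i : ℝ) ^ 2 + 2 * (Kb P i : ℝ) ^ 4)))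
    -- the geometric letter: every fine site whose k-block label lies in the box `[lo − 1, hi + 1]` lies in `Ω₁(Z)` (print: `Λ` deep inside `Z`); dag-n12-c's `far_letter_of_box` turns it into the bond letter `hfar`
    (hZ1 : ∀ P i (y : Site (F.P P.K) 0), B14.Eq22Determines.blockIter (k P i) y ∈ (castSite '' Set.Icc (lo P i - 1) (hi P i + 1) : Set (Site (F.P P.K) (k P i))) → y ∈ maxDomT (theta13OfThm1CCM F 2 jM ε₀ ε₂₉ B₃c B₃' a₀ a₁).ν.M₁ (Z P i) 1)
    -- (Gᵃ) `Z` a union of `k`-blocks (print's `Z` is a union of `M`-cubes of `T₁^{(k)}`)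
    (hZblk : ∀ P i, B14.Eq22Determines.IsBlockUnion (k P i) (Z P i))
    -- (Gᵇ) DISCHARGED (dag-n12-c §8): print's `M₁ ≥ 2` and, per instance, the torus divisibility `L^{k}·M₁ ∣ 2L^{m+K}` of the `LʲM₁`-cube partitions
    (hdiv : ∀ P i, B14.Eq213MaximalDomains.side (F.P P.K).L (theta13OfThm1CCM F 2 jM ε₀ ε₂₉ B₃c B₃' a₀ a₁).ν.M₁ (k P i) ∣ (F.P P.K).sitesPerDir 0)
    -- bookkeeping constants of the (Vn) derivation (`c_E`, print's `B₃` of [15] Thm 1, the threshold `a₁'`, the near-value constant `c_A`), per run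
    {cE B₃ a₁' cA : B12.RunParams → ℝ} (hcE0 : ∀ P, 0 ≤ cE P) (hcE : ∀ P i, 12 * ((F.P P.K).d : ℝ) * ((n P i : ℝ) + 2) ^ 2 ≤ cE P) (hB₃ : ∀ P, 0 ≤ B₃ P)
    (heRa : ∀ P i, (cE P + 1) * eR P i ≤ a₁' P ∧ B₃ P * ((cE P + 1) * eR P i) ≤ (theta13OfThm1CCM F 2 jM ε₀ ε₂₉ B₃c B₃' a₀ a₁).ν.εreg)
    (hcA : ∀ P, 1 / 2 * (B₃ P * (cE P + 1) * (F.P P.K).eta 1 ^ 2) ^ 2 * (Fintype.card (Plaq (F.P P.K) 0) : ℝ) ≤ cA P)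
    -- [15] THEOREM 1 (R) AT `Z`'s OWN SEQUENCE, per run and instance (dag-n12-c's instance-level letter `h15Z`; NODE 00's general-sequence [15]-leaf serves it by ONE application — dag-n12-c LOCATED-GENFORM)
    (h15Z : ∀ P i (δ : ℕ → ℝ), (∀ j, j ≤ k P i → 0 < δ j ∧ δ j ≤ a₁' P ∧ B₃ P * δ j ≤ (theta13OfThm1CCM F 2 jM ε₀ ε₂₉ B₃c B₃' a₀ a₁).ν.εreg) → (∀ j, j < k P i → δ j ≤ 2 * δ (j + 1)) →
      (∀ j, j < k P i → δ (j + 1) ≤ 2 * δ j) →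
      ∀ W : MSField (F.P P.K) SU2,
        Node00.Sect2.DataSmall7PTop (Node00.avOfRecord F 2 P.K) (maxDomT (theta13OfThm1CCM F 2 jM ε₀ ε₂₉ B₃c B₃' a₀ a₁).ν.M₁ (Z P i)) (Node00.suppDomOfRecord F (theta13OfThm1CCM F 2 jM ε₀ ε₂₉ B₃c B₃' a₀ a₁).ν P.K (maxDomT (theta13OfThm1CCM F 2 jM ε₀ ε₂₉ B₃c B₃' a₀ a₁).ν.M₁ (Z P i))) (k P i) δ W →
        ∀ U₀ : GaugeField (F.P P.K) 0 SU2, IsMinimizer (Node00.avOfRecord F 2 P.K)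
            {U | (∀ j, j ≤ k P i → PlaqSmallOn (Node00.Sect2.omegaPlaqsTop (maxDomT (theta13OfThm1CCM F 2 jM ε₀ ε₂₉ B₃c B₃' a₀ a₁).ν.M₁ (Z P i)) (Node00.suppDomOfRecord F (theta13OfThm1CCM F 2 jM ε₀ ε₂₉ B₃c B₃' a₀ a₁).ν P.K (maxDomT (theta13OfThm1CCM F 2 jM ε₀ ε₂₉ B₃c B₃' a₀ a₁).ν.M₁ (Z P i))) j)
                (((theta13OfThm1CCM F 2 jM ε₀ ε₂₉ B₃c B₃' a₀ a₁).ν.εreg : ℝ) * (F.P P.K).eta j ^ 2) U) ∧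
              Node00.Sect2.CoDivClassOnTop (maxDomT (theta13OfThm1CCM F 2 jM ε₀ ε₂₉ B₃c B₃' a₀ a₁).ν.M₁ (Z P i)) (Node00.suppDomOfRecord F (theta13OfThm1CCM F 2 jM ε₀ ε₂₉ B₃c B₃' a₀ a₁).ν P.K (maxDomT (theta13OfThm1CCM F 2 jM ε₀ ε₂₉ B₃c B₃' a₀ a₁).ν.M₁ (Z P i))) (k P i) (theta13OfThm1CCM F 2 jM ε₀ ε₂₉ B₃c B₃' a₀ a₁).ν.εreg U}
            (genSet (maxDomT (theta13OfThm1CCM F 2 jM ε₀ ε₂₉ B₃c B₃' a₀ a₁).ν.M₁ (Z P i)) (k P i)) W U₀ →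
          (∀ j, j ≤ k P i → PlaqSmallOn (Node00.Sect2.omegaPlaqsTop (maxDomT (theta13OfThm1CCM F 2 jM ε₀ ε₂₉ B₃c B₃' a₀ a₁).ν.M₁ (Z P i)) (Node00.suppDomOfRecord F (theta13OfThm1CCM F 2 jM ε₀ ε₂₉ B₃c B₃' a₀ a₁).ν P.K (maxDomT (theta13OfThm1CCM F 2 jM ε₀ ε₂₉ B₃c B₃' a₀ a₁).ν.M₁ (Z P i))) j)
              (B₃ P * δ j * (F.P P.K).eta j ^ 2) U₀) ∧
            ∀ j, j ≤ k P i → Node00.Sect2.CoDivSmallOn (Node00.Sect2.omegaBondsTop (maxDomT (theta13OfThm1CCM F 2 jM ε₀ ε₂₉ B₃c B₃' a₀ a₁).ν.M₁ (Z P i)) (Node00.suppDomOfRecord F (theta13OfThm1CCM F 2 jM ε₀ ε₂₉ B₃c B₃' a₀ a₁).ν P.K (maxDomT (theta13OfThm1CCM F 2 jM ε₀ ε₂₉ B₃c B₃' a₀ a₁).ν.M₁ (Z P i))) j)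
              (B₃ P * δ j * (F.P P.K).eta j ^ 3) U₀)
    (hcJ' : ∀ P i, 2 * cA P * eR P i / R P i + 4 * 𝓐 P i / (R P i * eR P i) ≤ cJ P) :
    ∃ areg : ∀ P : B12.RunParams, ι P → ℝ, (∀ P i, 0 < areg P i) ∧
      ∀ P : B12.RunParams, lam.kSel P < P.K →
        B15Leaf (WOfRecord₁₃ F 2 (theta13OfThm1CCM F 2 jM ε₀ ε₂₉ B₃c B₃' a₀ a₁)
          { lam with LF := fun P => lfVarOn su2Chart fun i => InstOn.std (bgMSCoPOfRecord F 2 (theta13OfThm1CCM F 2 jM ε₀ ε₂₉ B₃c B₃' a₀ a₁).ν P.K (k P i) (maxDomT (theta13OfThm1CCM F 2 jM ε₀ ε₂₉ B₃c B₃' a₀ a₁).ν.M₁ (Z P i))) (theta13OfThm1CCM F 2 jM ε₀ ε₂₉ B₃c B₃' a₀ a₁).ν.M₁ (Z P i) (Λ P i) (k P i) (M P i) (areg P i)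
                            (anExt (pts (k P i) (Λ P i)) (T P i) (fun177std (bgMSCoPOfRecord F 2 (theta13OfThm1CCM F 2 jM ε₀ ε₂₉ B₃c B₃' a₀ a₁).ν P.K (k P i) (maxDomT (theta13OfThm1CCM F 2 jM ε₀ ε₂₉ B₃c B₃' a₀ a₁).ν.M₁ (Z P i))) (theta13OfThm1CCM F 2 jM ε₀ ε₂₉ B₃c B₃' a₀ a₁).ν.M₁ (Z P i) (k P i)) (ext P i)
                              (min (1 / 2) (min (R P i / 8) (γ P / (M P i) ^ 5 * (R P i / 2) ^ 2 / (48 * (4 * 𝓐 P i / R P i + 1)))))) } P) := by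
  -- `2 ≤ M₁ = L^{jM}` at the collared witness (`1 ≤ jM`, `1 < L`; dag-n21-c's `theta13OfThm1CCM_M₁`, `rfl`)
  have h2 : 2 ≤ F.L ^ jM :=
    calc 2 ≤ F.L := F.hL.2
      _ = F.L ^ 1 := (pow_one _).symm
      _ ≤ F.L ^ jM := Nat.pow_le_pow_right (Nat.zero_lt_of_lt F.hL.2) hjM
  exact exists_pinLF_b15Leaf_WOfRecord₁₃_liveRepin₁₃_of_massLive_of_hasResiduals_of_thm1AtZSeqLetters_atZSeqCoPRecord_geom
    (theta13OfNumerics F 2 (stage12NumericsOfThm1CCM F.L jM ε₀ B₃c B₃' a₀ a₁) ε₂₉ (zeta316OfRecord F 2 (stage12NumericsOfThm1CCM F.L jM ε₀ B₃c B₃' a₀ a₁).ν (stage12NumericsOfThm1CCM F.L jM ε₀ B₃c B₃' a₀ a₁).τ9.M (stage12NumericsOfThm1CCM F.L jM ε₀ B₃c B₃' a₀ a₁).A₁) (RzOfRecord F 2) (ZtOfRecord F 2)) lam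
    (hasResidualsOfRecord_theta13OfNumerics F 2 (stage12NumericsOfThm1CCM F.L jM ε₀ B₃c B₃' a₀ a₁) ε₂₉) (hM2 := h2)
    (hpin := hpin) (hmassLive := hmassLive) (h180 := h180) (h189 := h189) (hd3 := hd3) (h0 := h0) (ι := ι) (Z := Z) (Λ := Λ)
    (k := k) (M := M) (hk0 := hk0) (hk := hk) (eR := eR) (heR := heR) (T := T) (lo := lo) (hi := hi)
    (n := n) (hn := hn) (hN := hN) (hbox := hbox) (hZ := hZ) (hTG0 := hTG0) (hN5 := hN5) (Kb := Kb) (hK1 := hK1)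
    (hKn := hKn) (ext := ext) (hext := hext) (hlohi := hlohi) (hγ := hγ) (hcJ := hcJ) (hbx := hbx) (hbxM := hbxM) (hM := hM)
    (hR := hR) (h𝓐 := h𝓐) (n' := n') (hn' := hn') (hGj := hGj) (hlead := hlead) (hsm := hsm) (hγle := hγle) (hZ1 := hZ1)
    (hZblk := hZblk) (hdiv := hdiv) (hcE0 := hcE0) (hcE := hcE) (hB₃ := hB₃) (heRa := heRa) (hcA := hcA) (h15Z := h15Z) (hcJ' := hcJ')
end AtThm1CCM
end Summit.QuantumFields.YangMills.BalabanUVNodes.N12AtRecord13Prop1KnitThm1AtZSeq
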